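import Summits.BirchSwinnertonDyer.BirchSwinnertonDyer.Theorems.KimAtThreeShallowEqDeepNoStubCruxes
import Summits.BirchSwinnertonDyer.BirchSwinnertonDyer.Theorems.KimAtThreeShallowEqDeepSplitGlue
import Summits.BirchSwinnertonDyer.BirchSwinnertonDyer.Theorems.KimAtThreeDeepUpperSplitGlue
import HarnessLib

/-!
# Route `KimAtThreeKolyvagin` (rung W2): the §U / §S tenure glues WITHOUT the stub child —
# `DeepUpperAtThree` and `ShallowEqDeepAtTorsionFree` from FIVE shared parts (Sakamoto ×2, GZK,
# Poitou–Tate, Carayol, PORT″) and the off-stratum child; `StubAtEmptyLevelThree` (19561) is not needed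

Cell `bsd-addord`, seat `bsd-addord-w2-c4` (D-0074 row B7), gen 4; sequel of
`KimAtThreeShallowEqDeepNoStubCruxes` (p444204).  Two theorems (no definition, no named fact, no `sorry`),
in the DECIDING-THEOREM shape of D-0027 §2.1 (hypotheses = items of the route BY NAME, conclusion = the
parent crux BY NAME); they close nothing by themselves (the parents 19076 / 19077 are SPLIT; the glue
items 19563 / 19600 are already closed WITH the stub among their hypotheses).  HONEST FRAMING: BSD is not
proved by any of this; the five shared parts are PUBLISHED inputs by name (Sakamoto 2024 Thm 4.4 (1)(2),
Gross–Zagier–Kolyvagin, Poitou–Tate, Carayol) plus the dictionary PORT″ (crux 19560, FLAG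
`K22-Thm3.13-PORT@3`, NOT in print at an additive `3`); the off-stratum children 19562 / 19599 stay OPEN.

WHAT (for the planner's next `--closes-file` / re-split):
* `deepUpperAtThree_of_parts_noStub : SakamotoKolyvaginThree → RankEqAnalyticRankLeOne →
  PoitouTateSelmerDuality → CarayolLevelEqConductor → KatoKuriharaPortThreeShared →
  DeepUpperAtThreeOffKatoStratum → DeepUpperAtThree` — the glue 19563 `DeepUpperAtThreeOfParts` with its
  sixth hypothesis `StubAtEmptyLevelThree` (crux 19561) DELETED;
* `shallowEqDeepAtTorsionFree_of_parts_noStub : SakamotoKolyvaginThree → RankEqAnalyticRankLeOne →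
  PoitouTateSelmerDuality → CarayolLevelEqConductor → KatoKuriharaPortThreeShared →
  ShallowEqDeepOffKatoStratum → ShallowEqDeepAtTorsionFree` — the glue 19600 `ShallowEqDeepOfParts` with the
  alias conjunction 19598 replaced by its five non-stub conjuncts.
Proofs: the planner's EnvW2 / EnvW2S2 proofs (landed as `KimAtThreeDeepUpperSplitGlue` p439802 and
`KimAtThreeShallowEqDeepSplitGlue`) VERBATIM, with w2-c3's `…_of_ports_of_towerSurj` / `…_of_ports_of_stub`
replaced by this seat's `deepUpper_optimal_of_poitouTate_noStub` / `shallowEqDeep_conclusion_classwide_noStub`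
(the stub is the theorem `KimAtThreeShallowEqDeepStubOfWitnesses.exists_eq_nsmul_add_of_witnesses`, p443395).
READING: crux 19561 `StubAtEmptyLevelThree` — Mazur–Rubin Thm 4.4.1 at `∅` for general `m`, AS FILED
(every depth `k`, no [S24] hypothesis) — is a true theorem of Kolyvagin-system theory but is NO LONGER an
input of either parent on this road; the planner may retire it.
[cite: Kim2025RefinedTNC, Thm 1.1 and Thm 1.2] [cite: Sakamoto2024, Thm. 4.4 (1)(2) (p. 926)]
[cite: MazurRubin2004, Thm. 4.4.1 and Thm. 5.2.12] [cite: Carayol1986] [cite: MilneADT2006, Ch. I, Thm. 4.10]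
-/

set_option autoImplicit false
-- the Theorems namespace of a single-conjunct summit repeats the summit name by design (D-0017)
set_option linter.dupNamespace false

noncomputable section

namespace Summit.BirchSwinnertonDyer.BirchSwinnertonDyer.Theorems.KimAtThreeShallowEqDeepSplitGlueNoStub

open scoped Classical NumberField
open Function IsDedekindDomain NumberField WeierstrassCurve
  Literature.NumberTheory.EllipticCurves Literature.NumberTheory.EllipticCurves.ModularForms
  Literature.NumberTheory.EllipticCurves.Rank1Residual
  Literature.NumberTheory.GaloisCohomology
  Summit.BirchSwinnertonDyer.Rank1Residual.GaloisImage
  Summit.BirchSwinnertonDyer.BirchSwinnertonDyer.Theorems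
  Summit.BirchSwinnertonDyer.BirchSwinnertonDyer.Theorems.KimAtThreeShallowEqDeepNoStubCruxes
  Summit.BirchSwinnertonDyer.BirchSwinnertonDyer.Theorems.KimAtThreeKolyvaginIsogenyCruxes
  Summit.BirchSwinnertonDyer.BirchSwinnertonDyer.Theses.KimAtThreeKolyvagin

/-- The place of `ℚ` above `3` and a generator of each `(ℤ/N𝔮)ˣ` (the two auxiliary data of the
END-OF-PORTS theorem, constructed as in the planner's glue proofs). [folklore] -/
theorem exists_place_three_and_generators :
    ∃ (v₃ : HeightOneSpectrum (𝓞 ℚ)) (η : (q : HeightOneSpectrum (𝓞 ℚ)) → (ZMod (Ideal.absNorm q.asIdeal))ˣ),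
      ((3 : ℕ) : 𝓞 ℚ) ∈ v₃.asIdeal ∧ ∀ q, Subgroup.zpowers (η q) = ⊤ := by
  let v₃ : HeightOneSpectrum (𝓞 ℚ) :=
    (Rat.HeightOneSpectrum.primesEquiv (R := 𝓞 ℚ)).symm ⟨3, Nat.prime_three⟩
  have hgen3 : Rat.HeightOneSpectrum.natGenerator v₃ = 3 :=
    congrArg Subtype.val
      ((Rat.HeightOneSpectrum.primesEquiv (R := 𝓞 ℚ)).apply_symm_apply ⟨3, Nat.prime_three⟩)
  have hv₃ : ((3 : ℕ) : 𝓞 ℚ) ∈ v₃.asIdeal := by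
    have h := Rat.HeightOneSpectrum.natCast_natGenerator_mem v₃
    rwa [hgen3] at h
  have hgen : ∀ q : HeightOneSpectrum (𝓞 ℚ), ∃ η : (ZMod (Ideal.absNorm q.asIdeal))ˣ,
      Subgroup.zpowers η = ⊤ := fun q => by
    haveI : Fact (Ideal.absNorm q.asIdeal).Prime := ⟨FSComp.prime_absNorm_rat q⟩
    obtain ⟨g, hg⟩ := IsCyclic.exists_generator (α := (ZMod (Ideal.absNorm q.asIdeal))ˣ)
    exact ⟨g, (Subgroup.eq_top_iff' _).mpr hg⟩
  choose η hη using hgen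
  exact ⟨v₃, η, hv₃, hη⟩

/-- **Crux `DeepUpperAtThree` (19076) from FIVE shared parts and the off-stratum child — NO stub.**
`SakamotoKolyvaginThree → RankEqAnalyticRankLeOne → PoitouTateSelmerDuality → CarayolLevelEqConductor →
KatoKuriharaPortThreeShared → DeepUpperAtThreeOffKatoStratum → DeepUpperAtThree`: the glue 19563 with the
hypothesis `StubAtEmptyLevelThree` removed (optimal-datum-at-conductor reduction, then
`deepUpper_optimal_of_poitouTate_noStub` ON the Kato stratum / the complement child OFF it).
[cite: Kim2025RefinedTNC, Thm. 1.1] [cite: Sakamoto2024, Thm. 4.4 (p. 926)] [cite: MazurRubin2004, Thm. 4.4.1] [cite: Carayol1986] -/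
theorem deepUpperAtThree_of_parts_noStub :
    SakamotoKolyvaginThree → RankEqAnalyticRankLeOne → PoitouTateSelmerDuality →
      CarayolLevelEqConductor → KatoKuriharaPortThreeShared → DeepUpperAtThreeOffKatoStratum →
        DeepUpperAtThree := by
  intro hSak hGZK hPT hlev hPort hOff
  refine deepUpperAtThree_of_forall_optimalDatum_atConductor hlev ?_
  intro W₀ _ _ htow hfin N _ hN D₀ hopt hdeg hint hord
  by_cases hroad :
      ((haveI : Fact (Nat.Prime 3) := ⟨Nat.prime_three⟩; Addv W₀ 3) ∧
        ¬ 3 ∣ (W₀.baseChange ℚ_[3]).localTamagawaNumber ℤ_[3] ∧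
        Nat.card {Q : (W₀.baseChange ℚ_[3]).toAffine.Point // (3 : ℕ) • Q = 0} = 1 ∧
        ¬ (3 : ℤ) ∣ D₀.maninConstant)
  · obtain ⟨hadd, hc3, ht0, hcD⟩ := hroad
    obtain ⟨v₃, η, hv₃, hη⟩ := exists_place_three_and_generators
    exact deepUpper_optimal_of_poitouTate_noStub hSak.1 hSak.2 hGZK hPT W₀ hadd hc3 htow ht0 D₀ hopt hcD
      hint hord v₃ hv₃ η hη (hPort W₀ htow hadd hc3 ht0 v₃ hv₃ η hη D₀ hN hopt hcD)
  · exact hOff W₀ htow hfin hN D₀ hopt hdeg hint hord hroad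

/-- **Crux `ShallowEqDeepAtTorsionFree` (19077) from FIVE shared parts and the off-stratum child — NO
stub.**  `SakamotoKolyvaginThree → RankEqAnalyticRankLeOne → PoitouTateSelmerDuality →
CarayolLevelEqConductor → KatoKuriharaPortThreeShared → ShallowEqDeepOffKatoStratum →
ShallowEqDeepAtTorsionFree`: the glue 19600 with the alias conjunction 19598 replaced by its five
non-stub conjuncts (optimal-datum-at-conductor reduction, then `shallowEqDeep_conclusion_classwide_noStub`
ON the Kato stratum / the complement child OFF it). [cite: Kim2025RefinedTNC, Thm. 1.1 and Thm. 1.2]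
[cite: Sakamoto2024, Thm. 4.4 (p. 926)] [cite: MazurRubin2004, Thm. 4.4.1 and Thm. 5.2.12] [cite: Carayol1986] -/
theorem shallowEqDeepAtTorsionFree_of_parts_noStub :
    SakamotoKolyvaginThree → RankEqAnalyticRankLeOne → PoitouTateSelmerDuality →
      CarayolLevelEqConductor → KatoKuriharaPortThreeShared → ShallowEqDeepOffKatoStratum →
        ShallowEqDeepAtTorsionFree := by
  intro hSak hGZK hPT hlev hPort hOff
  refine shallowEqDeepAtTorsionFree_of_forall_optimalDatum_atConductor hlev ?_
  intro W₀ _ _ htow ht0 hfin N _ hN D₀ hopt hdeg hint hord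
  by_cases hroad :
      ((haveI : Fact (Nat.Prime 3) := ⟨Nat.prime_three⟩; Addv W₀ 3) ∧
        ¬ 3 ∣ (W₀.baseChange ℚ_[3]).localTamagawaNumber ℤ_[3] ∧
        ¬ (3 : ℤ) ∣ D₀.maninConstant)
  · obtain ⟨hadd, hc3, hcD⟩ := hroad
    obtain ⟨v₃, η, hv₃, hη⟩ := exists_place_three_and_generators
    exact shallowEqDeep_conclusion_classwide_noStub hSak.1 hSak.2 hGZK hPT W₀ W₀ (IsIsogenous.refl_holds W₀)
      hadd htow ht0 hc3 hN D₀ hopt hcD hint v₃ hv₃ η hη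
      (hPort W₀ htow hadd hc3 ht0 v₃ hv₃ η hη D₀ hN hopt hcD) hord
  · exact hOff W₀ htow ht0 hfin hN D₀ hopt hdeg hint hord hroad

/-- **The §S glue in the filed alias currency, NO stub**: from the six-part alias conjunction 19598
`DeepUpperSplitSharedParts` with its LAST conjunct (the stub) simply IGNORED — i.e. the landed glue 19600
does not actually depend on `StubAtEmptyLevelThree`. [cite: Kim2025RefinedTNC, Thm. 1.2] [cite: MazurRubin2004, Thm. 4.4.1] -/
theorem shallowEqDeepOfParts_noStub_reading :
    DeepUpperSplitSharedParts → ShallowEqDeepOffKatoStratum → ShallowEqDeepAtTorsionFree := by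
  rintro ⟨hSak, hGZK, hPT, hlev, hPort, -⟩ hOff
  exact shallowEqDeepAtTorsionFree_of_parts_noStub hSak hGZK hPT hlev hPort hOff

end Summit.BirchSwinnertonDyer.BirchSwinnertonDyer.Theorems.KimAtThreeShallowEqDeepSplitGlueNoStub

end
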